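import Summits.Parity.GeneralizedHardyLittlewood.Theorems.PrimeLevelFamEdgeIdeaDeltasFloorDualTame
import Literature.Analysis.Fourier.FermionicPoissonSummation
import Mathlib.Analysis.Fourier.Inversion
import HarnessLib

/-!
# Route `PrimeLevelFamEdge` — TYPED IDEA DELTAS, deck 18f: K-L21-3 — the two CONTENT inputs of `QuarterParseval`, PROVED:
# (i) POISSON SUMMATION ON `¼ℤ` for the quadratic-decay class (`quarter_poisson`: `Σ_j r̂(4(x+j)) = ¼ Σ_n r(n/4) e^{2πinx}`
# for even continuous `r ∈ L¹` with `|r|, |r̂| ≤ C/(1+x²)`, from Mathlib `Real.tsum_eq_tsum_fourier_of_rpow_decay` +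
# `fourier_ofReal_eq_cosTransform` (`𝓕r = r̂`) + Fourier inversion `fourier_cosTransform_eq` (`𝓕r̂ = r`)); (ii) the residue
# table defining `quarterCoeff` IS the Fourier-coefficient table of the explicit period measure
# (`four_mul_quarterCoeff_eq_integral`: `4c_k = 1 + 2∫₀¹ β cos(πkβ/2) dβ + 2t ∫₁² cos(πkβ/2) dβ + b(−1)^k`, `k ≥ 1`).
# What remains TYPED in `QuarterParseval` (deck 18d) is cell bookkeeping (Fubini over one period of `quarterNu` and the
# `ℤ → ℕ` folding).  Seat ls-idea-lens-21 g2, `Sketch_L21_DualWitness.lean` v1.5 sha16 ca34d43d91700569 l.867–1154 VERBATIM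
# up to the namespace (critic F b26.6: v1.5 VERIFIED, axioms std, PSF read confirmed, integrals re-derived termwise); typer
# ls-idea-typ-1 gen 3.  HONESTY: Fourier bookkeeping for an explicit lattice–periodic pair, nothing about ζ; no exceptional-zero
# theorem (no Landau–Siegel / Siegel-zero exclusion, no Theorem 1–2 of arXiv:2211.02515, no repaired Margin232) is proved;
# typed ≠ proved for `QuarterParseval` itself.
-/

namespace Summit.Parity.GeneralizedHardyLittlewood.Theorems.PrimeLevelFamEdgeIdeaDeltas.FloorDual

open Literature.NumberTheory.LFunctions MeasureTheory
open scoped Real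

/-! ### v1.5 · POISSON SUMMATION ON `¼ℤ` FOR THE QUADRATIC-DECAY CLASS
(the Fourier-analytic input of `QuarterParseval`, PROVED from Mathlib's Poisson formula and Fourier
inversion: for even continuous `r ∈ L¹` with `|r|, |r̂| ≤ C/(1+x²)`,
`Σ_{j∈ℤ} r̂(4(x+j)) = ¼ Σ_{n∈ℤ} r(n/4) e^{2πinx}`; what then remains of `QuarterParseval` is the cell
bookkeeping `∫ r̂ dμ = ∫_{one period} (Σ_j r̂(·+4j)) dμ₀` + four trigonometric integrals). -/

section Poisson
open scoped FourierTransform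
open Complex (I)

/-- Quadratic decay gives the `O(|x|^{-2})` hypothesis of Mathlib's Poisson formula. -/
theorem isBigO_of_quadratic_decay {g : ℝ → ℂ} {C : ℝ} (h : ∀ x : ℝ, ‖g x‖ ≤ C / (1 + x ^ 2)) :
    g =O[Filter.cocompact ℝ] fun x : ℝ => |x| ^ (-(2 : ℝ)) := by
  have hC0 : 0 ≤ C := by
    have := h 0
    simp only [ne_eq, OfNat.ofNat_ne_zero, not_false_eq_true, zero_pow, add_zero, div_one] at this
    exact le_trans (norm_nonneg _) this
  refine Asymptotics.IsBigO.of_bound C ?_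
  filter_upwards [(isCompact_singleton (x := (0 : ℝ))).compl_mem_cocompact] with x hx
  have hx0 : x ≠ 0 := by simpa using hx
  have hx2 : 0 < x ^ 2 := by positivity
  have hrpow : |x| ^ (-(2 : ℝ)) = (x ^ 2)⁻¹ := by
    rw [Real.rpow_neg (abs_nonneg x), show (2 : ℝ) = ((2 : ℕ) : ℝ) by norm_num, Real.rpow_natCast,
      sq_abs]
  rw [hrpow, Real.norm_of_nonneg (by positivity), ← div_eq_mul_inv]
  exact le_trans (h x) (div_le_div_of_nonneg_left hC0 hx2 (by linarith))

/-- `r · cos(c·)` is integrable for `r ∈ L¹`. -/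
theorem integrable_mul_cos {r : ℝ → ℝ} (hint : Integrable r) (c : ℝ) :
    Integrable fun v : ℝ => r v * Real.cos (c * v) := by
  refine Integrable.mono' hint.norm
    (hint.aestronglyMeasurable.mul (Continuous.aestronglyMeasurable (by fun_prop))) ?_
  filter_upwards with v
  simp only [norm_mul, Real.norm_eq_abs]
  exact mul_le_of_le_one_right (abs_nonneg _) (Real.abs_cos_le_one _)

/-- `r · sin(c·)` is integrable for `r ∈ L¹`. -/
theorem integrable_mul_sin {r : ℝ → ℝ} (hint : Integrable r) (c : ℝ) :
    Integrable fun v : ℝ => r v * Real.sin (c * v) := by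
  refine Integrable.mono' hint.norm
    (hint.aestronglyMeasurable.mul (Continuous.aestronglyMeasurable (by fun_prop))) ?_
  filter_upwards with v
  simp only [norm_mul, Real.norm_eq_abs]
  exact mul_le_of_le_one_right (abs_nonneg _) (Real.abs_sin_le_one _)

/-- The sine transform of an even function vanishes. -/
theorem integral_mul_sin_eq_zero {r : ℝ → ℝ} (heven : ∀ u : ℝ, r (-u) = r u) (c : ℝ) :
    ∫ v : ℝ, r v * Real.sin (c * v) = 0 := by
  have h1 := integral_neg_eq_self (fun v : ℝ => r v * Real.sin (c * v)) volume
  have h2 : (fun v : ℝ => r (-v) * Real.sin (c * -v)) = fun v => -(r v * Real.sin (c * v)) := by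
    funext v; rw [heven, mul_neg, Real.sin_neg]; ring
  rw [h2, integral_neg] at h1
  linarith

/-- For an even real `r ∈ L¹`, the Fourier transform of `r` (complexified) is the cosine transform `r̂`. -/
theorem fourier_ofReal_eq_cosTransform {r : ℝ → ℝ} (heven : ∀ u : ℝ, r (-u) = r u)
    (hint : Integrable r) (w : ℝ) :
    𝓕 (fun u : ℝ => (r u : ℂ)) w = (BGMM2023.cosTransform r w : ℂ) := by
  rw [Real.fourier_real_eq_integral_exp_smul]
  have hpt : (fun v : ℝ => Complex.exp (↑(-2 * π * v * w) * I) • ((r v : ℝ) : ℂ))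
      = fun v : ℝ => ((r v * Real.cos (2 * π * w * v) : ℝ) : ℂ)
          + ((-(r v * Real.sin (2 * π * w * v)) : ℝ) : ℂ) * I := by
    funext v
    rw [smul_eq_mul, Complex.exp_mul_I, ← Complex.ofReal_cos, ← Complex.ofReal_sin,
      show (-2 * π * v * w : ℝ) = -(2 * π * w * v) by ring, Real.cos_neg, Real.sin_neg]
    push_cast
    ring
  rw [hpt, integral_add, integral_complex_ofReal, integral_mul_const, integral_complex_ofReal,
    integral_neg, integral_mul_sin_eq_zero heven, neg_zero]
  · unfold BGMM2023.cosTransform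
    push_cast
    simp
  · exact (integrable_mul_cos hint _).ofReal
  · exact ((integrable_mul_sin hint _).neg.ofReal).mul_const _

/-- `r̂` (complexified) is integrable under quadratic decay. -/
theorem integrable_ofReal_of_quadratic_decay {R : ℝ → ℝ} (hR : Continuous R)
    (hdecay : ∃ C : ℝ, ∀ α : ℝ, |R α| ≤ C / (1 + α ^ 2)) :
    Integrable fun α : ℝ => (R α : ℂ) := by
  obtain ⟨C, hC⟩ := hdecay
  have hvol : Integrable R volume := by
    refine Integrable.mono' ((integrable_inv_one_add_sq).const_mul C) hR.aestronglyMeasurable ?_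
    filter_upwards with α
    rw [Real.norm_eq_abs]
    simpa [div_eq_mul_inv] using hC α
  exact hvol.ofReal

/-- FOURIER INVERSION for the class: `𝓕 r̂ = r` (even `r`, continuous, `L¹`, `r̂` of quadratic decay). -/
theorem fourier_cosTransform_eq {r : ℝ → ℝ} (heven : ∀ u : ℝ, r (-u) = r u) (hcont : Continuous r)
    (hint : Integrable r)
    (htdecay : ∃ C : ℝ, ∀ α : ℝ, |BGMM2023.cosTransform r α| ≤ C / (1 + α ^ 2)) (ξ : ℝ) :
    𝓕 (fun α : ℝ => (BGMM2023.cosTransform r α : ℂ)) ξ = (r ξ : ℂ) := by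
  have h1 : (fun α : ℝ => (BGMM2023.cosTransform r α : ℂ)) = 𝓕 (fun u : ℝ => (r u : ℂ)) := by
    funext α; rw [fourier_ofReal_eq_cosTransform heven hint]
  have hFint : Integrable (𝓕 (fun u : ℝ => (r u : ℂ))) := by
    rw [← h1]; exact integrable_ofReal_of_quadratic_decay (continuous_cosTransform hint) htdecay
  have hinv := Continuous.fourierInv_fourier_eq (f := fun u : ℝ => (r u : ℂ)) (by fun_prop)
    hint.ofReal hFint
  have := congrFun hinv (-ξ)
  rw [Real.fourierInv_eq_fourier_neg, neg_neg] at this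
  rw [h1, this]
  simp [heven]

/-- **POISSON SUMMATION ON `¼ℤ`** for the quadratic-decay class (PROVED):
`Σ_{j∈ℤ} r̂(4(x+j)) = ¼ Σ_{n∈ℤ} r(n/4) e^{2πinx}`. -/
theorem quarter_poisson {r : ℝ → ℝ} (heven : ∀ u : ℝ, r (-u) = r u) (hcont : Continuous r)
    (hint : Integrable r) (hdecay : ∃ C : ℝ, ∀ u : ℝ, |r u| ≤ C / (1 + u ^ 2))
    (htdecay : ∃ C : ℝ, ∀ α : ℝ, |BGMM2023.cosTransform r α| ≤ C / (1 + α ^ 2)) (x : ℝ) :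
    ∑' j : ℤ, (BGMM2023.cosTransform r (4 * (x + j)) : ℂ) =
      ∑' n : ℤ, (1 / 4 : ℂ) * (r ((n : ℝ) / 4) : ℂ) * fourier n (x : UnitAddCircle) := by
  obtain ⟨C, hC⟩ := hdecay
  obtain ⟨C', hC'⟩ := htdecay
  set F : ℝ → ℂ := fun α => (BGMM2023.cosTransform r α : ℂ) with hFdef
  have hC0 : 0 ≤ C := by
    have := hC 0
    simp only [ne_eq, OfNat.ofNat_ne_zero, not_false_eq_true, zero_pow, add_zero, div_one] at this
    exact le_trans (abs_nonneg _) this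
  have hC0' : 0 ≤ C' := by
    have := hC' 0
    simp only [ne_eq, OfNat.ofNat_ne_zero, not_false_eq_true, zero_pow, add_zero, div_one] at this
    exact le_trans (abs_nonneg _) this
  -- decay of the dilated transform
  have hf : (fun y : ℝ => F (4 * y)) =O[Filter.cocompact ℝ] fun y : ℝ => |y| ^ (-(2 : ℝ)) := by
    refine isBigO_of_quadratic_decay (C := C') fun y => ?_
    simp only [hFdef, Complex.norm_real, Real.norm_eq_abs]
    refine le_trans (hC' (4 * y)) (div_le_div_of_nonneg_left hC0' (by positivity) ?_)
    nlinarith [sq_nonneg y]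
  -- the Fourier transform of the dilated transform is `¼ r(ξ/4)`
  have hFf_eq : 𝓕 (fun y : ℝ => F (4 * y)) = fun ξ : ℝ => (1 / 4 : ℂ) * (r (ξ / 4) : ℂ) := by
    funext ξ
    rw [Literature.Analysis.Fourier.fourier_comp_mul_left F (by norm_num : (0 : ℝ) < 4) ξ, hFdef,
      fourier_cosTransform_eq heven hcont hint ⟨C', hC'⟩]
    push_cast
    ring
  have hFf : 𝓕 (fun y : ℝ => F (4 * y)) =O[Filter.cocompact ℝ] fun y : ℝ => |y| ^ (-(2 : ℝ)) := by
    rw [hFf_eq]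
    refine isBigO_of_quadratic_decay (C := 4 * C) fun ξ => ?_
    rw [norm_mul, Complex.norm_real, Real.norm_eq_abs,
      show ‖(1 / 4 : ℂ)‖ = 1 / 4 by simp]
    have h1 := hC (ξ / 4)
    have h2 : C / (1 + (ξ / 4) ^ 2) ≤ 4 * (4 * C / (1 + ξ ^ 2)) := by
      rw [div_le_iff₀ (by positivity), show 4 * (4 * C / (1 + ξ ^ 2)) * (1 + (ξ / 4) ^ 2)
        = C * ((16 + ξ ^ 2) / (1 + ξ ^ 2)) by field_simp; ring]
      have : 1 ≤ (16 + ξ ^ 2) / (1 + ξ ^ 2) := by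
        rw [le_div_iff₀ (by positivity)]; linarith
      nlinarith
    linarith
  have hcF : Continuous fun y : ℝ => F (4 * y) :=
    (Complex.continuous_ofReal.comp (continuous_cosTransform hint)).comp (by fun_prop)
  have key := Real.tsum_eq_tsum_fourier_of_rpow_decay hcF one_lt_two hf hFf x
  rw [hFf_eq] at key
  simpa [hFdef] using key

/-- Mesh form at `x = 0`: `Σ_{j∈ℤ} r̂(4j) = ¼ Σ_{n∈ℤ} r(n/4)`. -/
theorem quarter_poisson_zero {r : ℝ → ℝ} (heven : ∀ u : ℝ, r (-u) = r u) (hcont : Continuous r)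
    (hint : Integrable r) (hdecay : ∃ C : ℝ, ∀ u : ℝ, |r u| ≤ C / (1 + u ^ 2))
    (htdecay : ∃ C : ℝ, ∀ α : ℝ, |BGMM2023.cosTransform r α| ≤ C / (1 + α ^ 2)) :
    ∑' j : ℤ, (BGMM2023.cosTransform r (4 * j) : ℂ) = ∑' n : ℤ, (1 / 4 : ℂ) * (r ((n : ℝ) / 4) : ℂ) := by
  have := quarter_poisson heven hcont hint hdecay htdecay 0
  simpa using this

end Poisson

/-! ### v1.5 · THE PAIR WEIGHTS `c_k` ARE THE FOURIER COEFFICIENTS OF THE EXPLICIT PERIOD MEASURE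
(PROVED: `4 c_k = 1 + 2∫₀¹ β cos(πkβ/2) dβ + 2t ∫₁² cos(πkβ/2) dβ + b(−1)^k` for `k ≥ 1`, i.e.
`c_k = ¼ ∫_{[−2,2)} cos(πkβ/2) dμ₀(β)` with `μ₀ = δ₀ + |β|dβ·𝟙_{|β|≤1} + t dβ·𝟙_{1<|β|≤2} + b δ₂`; this
certifies the residue table defining `quarterCoeff` against the measures `quarterRho`/`quarterNu`.) -/

section Coefficients

/-- `∫₁² cos(aβ) dβ = (sin 2a − sin a)/a`. -/
theorem integral_cos_mul_one_two {a : ℝ} (ha : a ≠ 0) :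
    ∫ β in (1 : ℝ)..2, Real.cos (a * β) = (Real.sin (2 * a) - Real.sin a) / a := by
  rw [intervalIntegral.integral_comp_mul_left (fun x => Real.cos x) ha, integral_cos, smul_eq_mul,
    mul_one, mul_comm a 2]
  field_simp

/-- `∫₀¹ β cos(aβ) dβ = sin a / a + (cos a − 1)/a²`. -/
theorem integral_mul_cos_zero_one {a : ℝ} (ha : a ≠ 0) :
    ∫ β in (0 : ℝ)..1, β * Real.cos (a * β) = Real.sin a / a + (Real.cos a - 1) / a ^ 2 := by
  have hderiv : ∀ x ∈ Set.uIcc (0 : ℝ) 1,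
      HasDerivAt (fun β : ℝ => β * Real.sin (a * β) / a + Real.cos (a * β) / a ^ 2)
        (x * Real.cos (a * x)) x := by
    intro x _
    have h1 : HasDerivAt (fun β : ℝ => a * β) a x := by
      simpa using (hasDerivAt_id x).const_mul a
    have hs : HasDerivAt (fun β : ℝ => Real.sin (a * β)) (Real.cos (a * x) * a) x :=
      (Real.hasDerivAt_sin (a * x)).comp x h1
    have hc : HasDerivAt (fun β : ℝ => Real.cos (a * β)) (-Real.sin (a * x) * a) x :=
      (Real.hasDerivAt_cos (a * x)).comp x h1
    have hprod : HasDerivAt (fun β : ℝ => β * Real.sin (a * β))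
        (1 * Real.sin (a * x) + x * (Real.cos (a * x) * a)) x := (hasDerivAt_id x).mul hs
    have := (hprod.div_const a).add (hc.div_const (a ^ 2))
    refine this.congr_deriv ?_
    field_simp
    ring
  rw [intervalIntegral.integral_eq_sub_of_hasDerivAt hderiv
    (by apply Continuous.intervalIntegrable; fun_prop)]
  simp only [mul_one, mul_zero, Real.sin_zero, Real.cos_zero, zero_div, zero_add]
  field_simp
  ring

/-- Reduction of `πk/2` modulo `2π` to the residue `k mod 4`. -/
theorem trig_quarter (k : ℕ) :
    Real.sin (π * k / 2) = Real.sin (π * ((k % 4 : ℕ) : ℝ) / 2) ∧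
      Real.cos (π * k / 2) = Real.cos (π * ((k % 4 : ℕ) : ℝ) / 2) := by
  have hk : (k : ℝ) = 4 * ((k / 4 : ℕ) : ℝ) + ((k % 4 : ℕ) : ℝ) := by
    exact_mod_cast (Nat.div_add_mod k 4).symm
  have e : π * k / 2 = π * ((k % 4 : ℕ) : ℝ) / 2 + ((k / 4 : ℕ) : ℝ) * (2 * π) := by
    rw [hk]; ring
  rw [e, Real.sin_add_nat_mul_two_pi, Real.cos_add_nat_mul_two_pi]
  exact ⟨rfl, rfl⟩

/-- `sin(3π/2) = −1`. -/
theorem sin_three_pi_div_two' : Real.sin (π * 3 / 2) = -1 := by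
  rw [show π * 3 / 2 = π / 2 + π by ring, Real.sin_add_pi, Real.sin_pi_div_two]

/-- `cos(3π/2) = 0`. -/
theorem cos_three_pi_div_two' : Real.cos (π * 3 / 2) = 0 := by
  rw [show π * 3 / 2 = π / 2 + π by ring, Real.cos_add_pi, Real.cos_pi_div_two, neg_zero]

/-- **THE RESIDUE TABLE IS THE FOURIER-COEFFICIENT TABLE** (PROVED): for `k ≥ 1`,
`4 c_k = 1 + 2∫₀¹ β cos(πkβ/2) dβ + 2t ∫₁² cos(πkβ/2) dβ + b (−1)^k`. -/
theorem four_mul_quarterCoeff_eq_integral (k : ℕ) (hk : 1 ≤ k) :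
    4 * quarterCoeff k =
      1 + 2 * (∫ β in (0 : ℝ)..1, β * Real.cos (π * k / 2 * β))
        + 2 * quarterLevel * (∫ β in (1 : ℝ)..2, Real.cos (π * k / 2 * β))
        + quarterAtom * (-1) ^ k := by
  have hπ : π ≠ 0 := Real.pi_ne_zero
  have hk0 : (k : ℝ) ≠ 0 := by
    have : (1 : ℝ) ≤ k := by exact_mod_cast hk
    linarith
  have ha : (π * k / 2 : ℝ) ≠ 0 := by positivity
  rw [integral_mul_cos_zero_one ha, integral_cos_mul_one_two ha]
  have h2a : Real.sin (2 * (π * k / 2)) = 0 := by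
    rw [show 2 * (π * k / 2) = (k : ℝ) * π by ring]; exact Real.sin_nat_mul_pi k
  rw [h2a]
  obtain ⟨hs, hc⟩ := trig_quarter k
  have h4 : k % 4 = 0 ∨ k % 4 = 1 ∨ k % 4 = 2 ∨ k % 4 = 3 := by omega
  unfold quarterCoeff
  rcases h4 with h | h | h | h
  · rw [if_pos h]
    rw [h] at hs hc
    simp only [Nat.cast_zero, mul_zero, zero_div, Real.sin_zero, Real.cos_zero] at hs hc
    have hev : Even k := Nat.even_iff.mpr (by omega)
    rw [hev.neg_one_pow, hs, hc]
    field_simp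
    ring
  · rw [if_neg (by omega), if_neg (by omega), if_pos h]
    rw [h] at hs hc
    simp only [Nat.cast_one, mul_one, Real.sin_pi_div_two, Real.cos_pi_div_two] at hs hc
    have hodd : Odd k := Nat.odd_iff.mpr (by omega)
    rw [hodd.neg_one_pow, hs, hc]
    field_simp
    ring
  · rw [if_neg (by omega), if_pos h]
    rw [h] at hs hc
    simp only [Nat.cast_ofNat] at hs hc
    rw [show π * 2 / 2 = π by ring] at hs hc
    rw [Real.sin_pi] at hs
    rw [Real.cos_pi] at hc
    have hev : Even k := Nat.even_iff.mpr (by omega)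
    rw [hev.neg_one_pow, hs, hc]
    field_simp
    ring
  · rw [if_neg (by omega), if_neg (by omega), if_neg (by omega)]
    rw [h] at hs hc
    simp only [Nat.cast_ofNat] at hs hc
    rw [sin_three_pi_div_two'] at hs
    rw [cos_three_pi_div_two'] at hc
    have hodd : Odd k := Nat.odd_iff.mpr (by omega)
    rw [hodd.neg_one_pow, hs, hc]
    field_simp
    ring

/-- The same in terms of the Montgomery core coefficient `A_k` (`coreCoeff`):
`4 c_k = A_k − 2t·sin(πk/2)/(πk/2) + b(−1)^k`. -/
theorem four_mul_quarterCoeff_eq_core (k : ℕ) (hk : 1 ≤ k) :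
    4 * quarterCoeff k =
      coreCoeff k - 2 * quarterLevel * (Real.sin (π * k / 2) / (π * k / 2))
        + quarterAtom * (-1) ^ k := by
  have hk0 : (k : ℝ) ≠ 0 := by
    have : (1 : ℝ) ≤ k := by exact_mod_cast hk
    linarith
  have ha : (π * k / 2 : ℝ) ≠ 0 := by positivity
  rw [four_mul_quarterCoeff_eq_integral k hk, integral_mul_cos_zero_one ha,
    integral_cos_mul_one_two ha, show 2 * (π * k / 2) = (k : ℝ) * π by ring, Real.sin_nat_mul_pi k]
  unfold coreCoeff
  field_simp
  ring

end Coefficients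

end Summit.Parity.GeneralizedHardyLittlewood.Theorems.PrimeLevelFamEdgeIdeaDeltas.FloorDual
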